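import Literature.RepresentationTheory.ModularTensorCategories.SU2FSymKL

/-!
# Row-unitarity of the `SU(2)_k` F-symbols from the Kauffman–Lins orthogonality identity

Topic `Literature/RepresentationTheory/ModularTensorCategories` (definition item `defn-ModularDatum`; step 3
of the transport prescribed by the review of the `SU(2)_k` bundle).

* `tetNet_perm2` — `Tet[d a e'; b c f] = Tet[a b f; c d e']` (same tetrahedron), `thetaNet_swap13`;
* `funit_core` — for admissible `(a,b,e),(e,c,d),(a,b,e'),(e',c,d),(b,c,f),(a,f,d)`:
  `F(e,f) F(e',f) = K(e,e') · {a b f; c d e} {d a e'; b c f}` with the `f`-INDEPENDENT factor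
  `K = (-1)^{(a+b+c+d)/2} √(|Δ_e Δ_e'|/|θ_abe θ_ecd θ_abe' θ_e'cd|) · θ(d,c,e')θ(a,b,e')/Δ_e'`
  (the `f`-dependent signs satisfy `(-1)^f = (-1)^{(a+b+c+d)/2}(-1)^{(a+f+d)/2}(-1)^{(b+c+f)/2}`);
  `funit_K_diag` — `K(e,e) = 1`;
* `fSym_row_sum` — `Σ_f F(e,f) F(e',f) = δ_{ee'}` from `KLOrthogonality k` (`j := e`, `k' := e'`);
* `fSym_unitary` — **`PreModularDatum.F_unitary` for `fSym k`**:
  `Σ_f fSym(a,b,c,d,e,f) conj(fSym(a,b,c,d,e',f)) = [e = e' ∧ N_{ab}^e N_{ec}^d ≠ 0]`.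
Column unitarity (`F_unitary'`) is the equal-cardinality square-matrix consequence (`fusionN_assoc`);
not in this file.
[cite: KauffmanLins1994, §7.3 Prop. 9 = §9.13 (orthogonality) and §9.10–9.12]
-/

noncomputable section

namespace Literature.RepresentationTheory.ModularTensorCategories.SU2LevelK

open Finset

variable (k : ℕ)

/-- `Tet[d a e'; b c f] = Tet[a b f; c d e']` (same tetrahedron: `aᵢ ↦ (a₄, a₃, a₁, a₂)`, `bⱼ ↦ (b₂, b₁, b₃)`).
[cite: KauffmanLins1994, §9.11] -/
theorem tetNet_perm2 (a b c d e' f : ℕ) : tetNet k d a e' b c f = tetNet k a b f c d e' := by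
  unfold tetNet
  simp only
  have e1 : (d + c + e') / 2 = (c + d + e') / 2 := by rw [Nat.add_comm d c]
  have e2 : (d + a + f) / 2 = (a + d + f) / 2 := by rw [Nat.add_comm d a]
  have e3 : (a + c + e' + f) / 2 = (a + c + f + e') / 2 := by rw [Nat.add_right_comm (a + c) e' f]
  have e4 : (d + b + e' + f) / 2 = (b + d + f + e') / 2 := by
    rw [show d + b + e' + f = b + d + f + e' by omega]
  have e5 : (d + a + b + c) / 2 = (a + b + c + d) / 2 := by
    rw [show d + a + b + c = a + b + c + d by omega]
  rw [e1, e2, e3, e4, e5]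
  generalize (a + d + f) / 2 = a₁
  generalize (b + c + f) / 2 = a₂
  generalize (a + b + e') / 2 = a₃
  generalize (c + d + e') / 2 = a₄
  generalize (b + d + f + e') / 2 = b₁
  generalize (a + c + f + e') / 2 = b₂
  generalize (a + b + c + d) / 2 = b₃
  rw [show max (max a₄ a₃) (max a₁ a₂) = max (max a₁ a₂) (max a₃ a₄) by
      rw [max_comm (max a₄ a₃), max_comm a₄ a₃],
    show min (min b₂ b₁) b₃ = min (min b₁ b₂) b₃ by rw [min_comm b₂ b₁]]
  congr 1
  · ring
  · refine Finset.sum_congr rfl (fun s _ => ?_)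
    ring

/-- `θ(d,c,e) = θ(e,c,d)`. [cite: KauffmanLins1994, §9.10 (i)] -/
theorem thetaNet_swap13 (d c e : ℕ) : thetaNet k d c e = thetaNet k e c d := by
  rw [thetaNet_comm k d c e, thetaNet_swap k c d e, thetaNet_comm k c e d]

end Literature.RepresentationTheory.ModularTensorCategories.SU2LevelK

namespace Literature.RepresentationTheory.ModularTensorCategories.SU2LevelK

open Finset

variable (k : ℕ)

/-- The `f`-independent factor relating `fSym(e,f) fSym(e',f)` to the Kauffman–Lins orthogonality
summand (all six triads admissible). [cite: KauffmanLins1994, §9.10–9.12] -/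
theorem funit_core {a b c d e e' f : ℕ} (h1 : Adm k a b e) (h2 : Adm k e c d) (h1' : Adm k a b e')
    (h2' : Adm k e' c d) (h3 : Adm k b c f) (h4 : Adm k a f d) :
    ((-1 : ℝ) ^ ((a + b + c + d) / 2) * Real.sqrt (qInt k (e + 1) * qInt k (f + 1)) * sixJ k a b e c d f) *
      ((-1 : ℝ) ^ ((a + b + c + d) / 2) * Real.sqrt (qInt k (e' + 1) * qInt k (f + 1)) * sixJ k a b e' c d f) =
    ((-1 : ℝ) ^ ((a + b + c + d) / 2) *
        Real.sqrt (|klDelta k e| * |klDelta k e'| /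
          (|thetaNet k a b e| * |thetaNet k e c d| * |thetaNet k a b e'| * |thetaNet k e' c d|)) *
        (thetaNet k d c e' * thetaNet k a b e' / klDelta k e')) *
      ((tetNet k a b f c d e * klDelta k f / (thetaNet k a d f * thetaNet k b c f)) *
        (tetNet k d a e' b c f * klDelta k e' / (thetaNet k d c e' * thetaNet k a b e'))) := by
  rw [fSym_core k h1 h2 h3 h4, fSym_core k h1' h2' h3 h4, tetNet_perm2 k a b c d e' f, thetaNet_swap13 k d c e']
  have g1 := h1; have g2 := h2; have g1' := h1'; have g2' := h2'; have g3 := h3; have g4 := h4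
  unfold Adm at g1 g2 g1' g2' g3 g4
  rw [thetaNet_swap k a d f, abs_thetaNet k h1, abs_thetaNet k h2, abs_thetaNet k h3, abs_thetaNet k h4,
    abs_thetaNet k h1', abs_thetaNet k h2',
    abs_klDelta k (by omega : e ≤ k), abs_klDelta k (by omega : f ≤ k), abs_klDelta k (by omega : e' ≤ k),
    thetaNet_eq_sign_mul k h3, thetaNet_eq_sign_mul k h4, thetaNet_eq_sign_mul k h1',
    thetaNet_eq_sign_mul k h2']
  unfold klDelta
  have hP1 := thetaPos k h1
  have hP2 := thetaPos k h2
  have hP3 := thetaPos k h3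
  have hP4 := thetaPos k h4
  have hP1' := thetaPos k h1'
  have hP2' := thetaPos k h2'
  -- signs
  have hσ : (-1 : ℝ) ^ f = (-1 : ℝ) ^ ((a + b + c + d) / 2) * (-1) ^ ((a + f + d) / 2) * (-1) ^ ((b + c + f) / 2) := by
    rw [← pow_add, ← pow_add, show (a + b + c + d) / 2 + (a + f + d) / 2 + (b + c + f) / 2 =
      2 * ((a + b + c + d) / 2) + f by omega, pow_add, pow_mul, neg_one_sq, one_pow, one_mul]
  have hs3 : ((-1 : ℝ) ^ ((b + c + f) / 2)) * (-1 : ℝ) ^ ((b + c + f) / 2) = 1 := by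
    rw [← pow_add, ← two_mul, pow_mul, neg_one_sq, one_pow]
  have hs4 : ((-1 : ℝ) ^ ((a + f + d) / 2)) * (-1 : ℝ) ^ ((a + f + d) / 2) = 1 := by
    rw [← pow_add, ← two_mul, pow_mul, neg_one_sq, one_pow]
  have hs0 : ((-1 : ℝ) ^ ((a + b + c + d) / 2)) * (-1 : ℝ) ^ ((a + b + c + d) / 2) = 1 := by
    rw [← pow_add, ← two_mul, pow_mul, neg_one_sq, one_pow]
  have hs1' : ((-1 : ℝ) ^ ((a + b + e') / 2)) * (-1 : ℝ) ^ ((a + b + e') / 2) = 1 := by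
    rw [← pow_add, ← two_mul, pow_mul, neg_one_sq, one_pow]
  have hs2' : ((-1 : ℝ) ^ ((e' + c + d) / 2)) * (-1 : ℝ) ^ ((e' + c + d) / 2) = 1 := by
    rw [← pow_add, ← two_mul, pow_mul, neg_one_sq, one_pow]
  have hse' : ((-1 : ℝ) ^ e') * (-1 : ℝ) ^ e' = 1 := by
    rw [← pow_add, ← two_mul, pow_mul, neg_one_sq, one_pow]
  rw [hσ]
  generalize (-1 : ℝ) ^ ((a + f + d) / 2) = σ₄ at hs4 ⊢
  generalize (-1 : ℝ) ^ ((b + c + f) / 2) = σ₃ at hs3 ⊢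
  generalize (-1 : ℝ) ^ ((a + b + c + d) / 2) = σ₀ at hs0 ⊢
  generalize (-1 : ℝ) ^ ((a + b + e') / 2) = σ₁' at hs1' ⊢
  generalize (-1 : ℝ) ^ ((e' + c + d) / 2) = σ₂' at hs2' ⊢
  generalize (-1 : ℝ) ^ e' = τ' at hse' ⊢
  have hqe : 0 < qInt k (e + 1) := qInt_pos k (by omega) (by omega)
  have hqe' : 0 < qInt k (e' + 1) := qInt_pos k (by omega) (by omega)
  have hqf : 0 < qInt k (f + 1) := qInt_pos k (by omega) (by omega)
  generalize qFactorial k ((a + b + e) / 2 + 1) * qFactorial k ((a + b - e) / 2) * qFactorial k ((b + e - a) / 2) *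
        qFactorial k ((a + e - b) / 2) / (qFactorial k b * qFactorial k e * qFactorial k a) = Θ₁ at hP1 ⊢
  generalize qFactorial k ((e + c + d) / 2 + 1) * qFactorial k ((e + c - d) / 2) * qFactorial k ((c + d - e) / 2) *
        qFactorial k ((e + d - c) / 2) / (qFactorial k c * qFactorial k d * qFactorial k e) = Θ₂ at hP2 ⊢
  generalize qFactorial k ((b + c + f) / 2 + 1) * qFactorial k ((b + c - f) / 2) * qFactorial k ((c + f - b) / 2) *
        qFactorial k ((b + f - c) / 2) / (qFactorial k c * qFactorial k f * qFactorial k b) = Θ₃ at hP3 ⊢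
  generalize qFactorial k ((a + f + d) / 2 + 1) * qFactorial k ((a + f - d) / 2) * qFactorial k ((f + d - a) / 2) *
        qFactorial k ((a + d - f) / 2) / (qFactorial k f * qFactorial k d * qFactorial k a) = Θ₄ at hP4 ⊢
  generalize qFactorial k ((a + b + e') / 2 + 1) * qFactorial k ((a + b - e') / 2) * qFactorial k ((b + e' - a) / 2) *
        qFactorial k ((a + e' - b) / 2) / (qFactorial k b * qFactorial k e' * qFactorial k a) = Θ₁' at hP1' ⊢
  generalize qFactorial k ((e' + c + d) / 2 + 1) * qFactorial k ((e' + c - d) / 2) * qFactorial k ((c + d - e') / 2) *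
        qFactorial k ((e' + d - c) / 2) / (qFactorial k c * qFactorial k d * qFactorial k e') = Θ₂' at hP2' ⊢
  generalize qInt k (e + 1) = qe at hqe ⊢
  generalize qInt k (e' + 1) = qe' at hqe' ⊢
  generalize qInt k (f + 1) = qf at hqf ⊢
  generalize tetNet k a b f c d e = X
  generalize tetNet k a b f c d e' = X'
  have nz4 : σ₄ ≠ 0 := fun h0 => by rw [h0, mul_zero] at hs4; exact zero_ne_one hs4
  have nz3 : σ₃ ≠ 0 := fun h0 => by rw [h0, mul_zero] at hs3; exact zero_ne_one hs3
  have nz1 : σ₁' ≠ 0 := fun h0 => by rw [h0, mul_zero] at hs1'; exact zero_ne_one hs1'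
  have nz2 : σ₂' ≠ 0 := fun h0 => by rw [h0, mul_zero] at hs2'; exact zero_ne_one hs2'
  have nzt : τ' ≠ 0 := fun h0 => by rw [h0, mul_zero] at hse'; exact zero_ne_one hse'
  set SA := Real.sqrt (qe * Θ₃ * Θ₄ / (qf * Θ₁ * Θ₂)) with hSA
  set SB := Real.sqrt (qe' * Θ₃ * Θ₄ / (qf * Θ₁' * Θ₂')) with hSB
  set W := Real.sqrt (qe * qe' / (Θ₁ * Θ₂ * Θ₁' * Θ₂')) with hW
  have hM2 : SA * SB = Θ₃ * Θ₄ / qf * W := by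
    rw [hSA, hSB, hW, ← Real.sqrt_mul (by positivity),
      ← Real.sqrt_sq (by positivity : (0 : ℝ) ≤ Θ₃ * Θ₄ / qf), ← Real.sqrt_mul (sq_nonneg _)]
    congr 1
    field_simp
  calc _ = (X * (σ₀ * σ₄ * σ₃ * qf) / (σ₄ * Θ₄ * (σ₃ * Θ₃))) *
        (X' * (σ₀ * σ₄ * σ₃ * qf) / (σ₄ * Θ₄ * (σ₃ * Θ₃))) * (SA * SB) := by ring
    _ = _ := by
      rw [hM2]
      field_simp

end Literature.RepresentationTheory.ModularTensorCategories.SU2LevelK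

namespace Literature.RepresentationTheory.ModularTensorCategories.SU2LevelK

open Finset
open scoped ComplexConjugate

variable (k : ℕ)

/-- The diagonal value of the `f`-independent factor is `1`. [cite: KauffmanLins1994, §9.10–9.12] -/
theorem funit_K_diag {a b c d e : ℕ} (h1 : Adm k a b e) (h2 : Adm k e c d) :
    (-1 : ℝ) ^ ((a + b + c + d) / 2) *
        Real.sqrt (|klDelta k e| * |klDelta k e| /
          (|thetaNet k a b e| * |thetaNet k e c d| * |thetaNet k a b e| * |thetaNet k e c d|)) *
        (thetaNet k d c e * thetaNet k a b e / klDelta k e) = 1 := by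
  have g1 := h1; have g2 := h2
  unfold Adm at g1 g2
  rw [thetaNet_swap13 k d c e, abs_thetaNet k h1, abs_thetaNet k h2, abs_klDelta k (by omega : e ≤ k),
    thetaNet_eq_sign_mul k h1, thetaNet_eq_sign_mul k h2]
  unfold klDelta
  have hP1 := thetaPos k h1
  have hP2 := thetaPos k h2
  have hqe : 0 < qInt k (e + 1) := qInt_pos k (by omega) (by omega)
  have hσ : (-1 : ℝ) ^ ((a + b + c + d) / 2) * (-1) ^ ((e + c + d) / 2) * (-1) ^ ((a + b + e) / 2) =
      (-1 : ℝ) ^ e := by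
    rw [← pow_add, ← pow_add, show (a + b + c + d) / 2 + (e + c + d) / 2 + (a + b + e) / 2 =
      2 * ((a + b + c + d) / 2) + e by omega, pow_add, pow_mul, neg_one_sq, one_pow, one_mul]
  have hτ : ((-1 : ℝ) ^ e) * (-1 : ℝ) ^ e = 1 := by rw [← pow_add, ← two_mul, pow_mul, neg_one_sq, one_pow]
  generalize qFactorial k ((a + b + e) / 2 + 1) * qFactorial k ((a + b - e) / 2) * qFactorial k ((b + e - a) / 2) *
        qFactorial k ((a + e - b) / 2) / (qFactorial k b * qFactorial k e * qFactorial k a) = Θ₁ at hP1 ⊢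
  generalize qFactorial k ((e + c + d) / 2 + 1) * qFactorial k ((e + c - d) / 2) * qFactorial k ((c + d - e) / 2) *
        qFactorial k ((e + d - c) / 2) / (qFactorial k c * qFactorial k d * qFactorial k e) = Θ₂ at hP2 ⊢
  generalize qInt k (e + 1) = qe at hqe ⊢
  rw [show qe * qe / (Θ₁ * Θ₂ * Θ₁ * Θ₂) = (qe / (Θ₁ * Θ₂)) ^ 2 by field_simp, Real.sqrt_sq (by positivity)]
  have nzτ : ((-1 : ℝ) ^ e) ≠ 0 := pow_ne_zero _ (by norm_num)
  rw [show (-1 : ℝ) ^ ((a + b + c + d) / 2) * (qe / (Θ₁ * Θ₂)) *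
      ((-1) ^ ((e + c + d) / 2) * Θ₂ * ((-1) ^ ((a + b + e) / 2) * Θ₁) / ((-1) ^ e * qe)) =
      ((-1 : ℝ) ^ ((a + b + c + d) / 2) * (-1) ^ ((e + c + d) / 2) * (-1) ^ ((a + b + e) / 2)) *
        ((-1 : ℝ) ^ e)⁻¹ * (qe * Θ₁ * Θ₂ / (Θ₁ * Θ₂ * qe)) by field_simp, hσ,
    show qe * Θ₁ * Θ₂ / (Θ₁ * Θ₂ * qe) = 1 by field_simp, mul_one, mul_inv_cancel₀ nzτ]

/-- **Row orthonormality of the `SU(2)_k` F-symbols at the level of natural-number labels**, from the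
Kauffman–Lins orthogonality identity: for admissible `(a,b,e), (e,c,d), (a,b,e'), (e',c,d)`,
`Σ_f F(e,f) F(e',f) = δ_{ee'}`. [cite: KauffmanLins1994, §7.3 Prop. 9 = §9.13] -/
theorem fSym_row_sum (hKO : KLOrthogonality k) {a b c d e e' : ℕ} (h1 : Adm k a b e) (h2 : Adm k e c d)
    (h1' : Adm k a b e') (h2' : Adm k e' c d) :
    ∑ f ∈ range (k + 1),
      (if Adm k b c f ∧ Adm k a f d then
          (-1 : ℝ) ^ ((a + b + c + d) / 2) * Real.sqrt (qInt k (e + 1) * qInt k (f + 1)) * sixJ k a b e c d f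
        else 0) *
      (if Adm k b c f ∧ Adm k a f d then
          (-1 : ℝ) ^ ((a + b + c + d) / 2) * Real.sqrt (qInt k (e' + 1) * qInt k (f + 1)) * sixJ k a b e' c d f
        else 0) = if e = e' then 1 else 0 := by
  have g1 := h1; have g2 := h2; have g1' := h1'; have g2' := h2'
  unfold Adm at g1 g2 g1' g2'
  have hK := hKO a b c d e e' (by omega) (by omega) (by omega) (by omega) (by omega) h1 ((adm_rot k).mpr h2)
  -- each summand is K · (the KL summand)
  set K : ℝ := (-1 : ℝ) ^ ((a + b + c + d) / 2) *
      Real.sqrt (|klDelta k e| * |klDelta k e'| /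
        (|thetaNet k a b e| * |thetaNet k e c d| * |thetaNet k a b e'| * |thetaNet k e' c d|)) *
      (thetaNet k d c e' * thetaNet k a b e' / klDelta k e') with hKdef
  have hterm : ∀ f : ℕ,
      (if Adm k b c f ∧ Adm k a f d then
          (-1 : ℝ) ^ ((a + b + c + d) / 2) * Real.sqrt (qInt k (e + 1) * qInt k (f + 1)) * sixJ k a b e c d f
        else 0) *
      (if Adm k b c f ∧ Adm k a f d then
          (-1 : ℝ) ^ ((a + b + c + d) / 2) * Real.sqrt (qInt k (e' + 1) * qInt k (f + 1)) * sixJ k a b e' c d f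
        else 0) = K * (sixjKL k a b f c d e * sixjKL k d a e' b c f) := by
    intro f
    by_cases hf : Adm k b c f ∧ Adm k a f d
    · obtain ⟨h3, h4⟩ := hf
      rw [if_pos ⟨h3, h4⟩, if_pos ⟨h3, h4⟩, funit_core k h1 h2 h1' h2' h3 h4, hKdef]
      unfold sixjKL
      rw [if_pos ⟨(adm_swap k).mp h4, h3, h1, (adm_rot k).mpr h2⟩,
        if_pos ⟨(adm_swap k).mp ((adm_rot k).mp h2'), h1', (adm_rot k).mp h4, h3⟩]
    · rw [if_neg hf, zero_mul]
      unfold sixjKL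
      rw [if_neg (fun h => hf ⟨h.2.1, (adm_swap k).mpr h.1⟩), zero_mul, mul_zero]
  simp_rw [hterm]
  rw [← Finset.mul_sum, hK]
  by_cases hee : e = e'
  · subst hee
    rw [if_pos rfl, mul_one, hKdef]
    exact funit_K_diag k h1 h2
  · rw [if_neg (Ne.symm hee), if_neg hee, mul_zero]

/-- **Unitarity (rows) of the `SU(2)_k` F-symbols** in the form of `PreModularDatum.F_unitary`, from the
Kauffman–Lins orthogonality identity `KLOrthogonality k` via the gauge relation.
[cite: KauffmanLins1994, §7.3 Prop. 9 = §9.13] -/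
theorem fSym_unitary (hKO : KLOrthogonality k) (a b c d e e' : Fin (k + 1)) :
    ∑ f : Fin (k + 1), fSym k a b c d e f * conj (fSym k a b c d e' f) =
      if e = e' ∧ fusionN k a b e * fusionN k e c d ≠ 0 then 1 else 0 := by
  have hconj : ∀ (x f : Fin (k + 1)), conj (fSym k a b c d x f) = fSym k a b c d x f := by
    intro x f; unfold fSym; split_ifs <;> simp [Complex.conj_ofReal]
  simp_rw [hconj]
  have hN : fusionN k a b e * fusionN k e c d ≠ 0 ↔ Adm k a b e ∧ Adm k e c d := by
    rw [mul_ne_zero_iff, fusionN_ne_zero_iff, fusionN_ne_zero_iff]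
  by_cases he : Adm k a b e ∧ Adm k e c d
  · by_cases he' : Adm k a b e' ∧ Adm k e' c d
    · -- main case
      have key := fSym_row_sum k hKO he.1 he.2 he'.1 he'.2
      have hsum : ∑ f : Fin (k + 1), fSym k a b c d e f * fSym k a b c d e' f =
          ((∑ f ∈ range (k + 1),
            (if Adm k b c f ∧ Adm k a f d then
                (-1 : ℝ) ^ (((a : ℕ) + b + c + d) / 2) * Real.sqrt (qInt k (e + 1) * qInt k (f + 1)) *
                  sixJ k a b e c d f else 0) *
            (if Adm k b c f ∧ Adm k a f d then
                (-1 : ℝ) ^ (((a : ℕ) + b + c + d) / 2) * Real.sqrt (qInt k (e' + 1) * qInt k (f + 1)) *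
                  sixJ k a b e' c d f else 0) : ℝ) : ℂ) := by
        rw [Complex.ofReal_sum, ← Fin.sum_univ_eq_sum_range (fun f =>
          (((if Adm k b c f ∧ Adm k a f d then
                (-1 : ℝ) ^ (((a : ℕ) + b + c + d) / 2) * Real.sqrt (qInt k (e + 1) * qInt k (f + 1)) *
                  sixJ k a b e c d f else 0) *
            (if Adm k b c f ∧ Adm k a f d then
                (-1 : ℝ) ^ (((a : ℕ) + b + c + d) / 2) * Real.sqrt (qInt k (e' + 1) * qInt k (f + 1)) *
                  sixJ k a b e' c d f else 0) : ℝ) : ℂ)) (k + 1)]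
        refine Finset.sum_congr rfl (fun f _ => ?_)
        unfold fSym
        by_cases hf : Adm k b c f ∧ Adm k a f d
        · rw [if_pos ⟨he.1, he.2, hf.1, hf.2⟩, if_pos ⟨he'.1, he'.2, hf.1, hf.2⟩, if_pos hf, if_pos hf]
          push_cast
          ring
        · rw [if_neg (fun h => hf ⟨h.2.2.1, h.2.2.2⟩), if_neg hf, zero_mul, zero_mul]
          simp
      rw [hsum, key]
      by_cases hee : e = e'
      · subst hee; rw [if_pos rfl, if_pos ⟨rfl, hN.mpr he⟩]; simp
      · rw [if_neg (fun h => hee (Fin.ext h)), if_neg (fun h => hee h.1)]; simp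
    · -- e' not admissible: every fSym(e', f) vanishes
      have h0 : ∀ f : Fin (k + 1), fSym k a b c d e' f = 0 := fun f => by
        unfold fSym; rw [if_neg (fun h => he' ⟨h.1, h.2.1⟩)]
      simp_rw [h0, mul_zero, Finset.sum_const_zero]
      rw [if_neg]
      rintro ⟨rfl, -⟩
      exact he' he
  · have h0 : ∀ f : Fin (k + 1), fSym k a b c d e f = 0 := fun f => by
      unfold fSym; rw [if_neg (fun h => he ⟨h.1, h.2.1⟩)]
    simp_rw [h0, zero_mul, Finset.sum_const_zero]
    rw [if_neg (fun h => he (hN.mp h.2))]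

end Literature.RepresentationTheory.ModularTensorCategories.SU2LevelK
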